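import Literature.Combinatorics.Optimization.MatchingSubgroupEquivariantPsdBound
import Literature.Computability.Complexity.Mod2SosDegreeExplicit
import HarnessLib

/-!
# Explicit constants for "the matching problem has no small symmetric SDP"

Source: G. Braun, J. Brown-Cohen, A. Huq, S. Pokutta, P. Raghavendra, A. Roy, B. Weitz, D. Zink,
*The matching problem has no small symmetric SDP*, Math. Program. 165 (2017) 643–662 =
arXiv:1504.00703, Thm. 4.10 (p. 9): "There exists an absolute constant `α > 0` such that for all
even `n` and every `0 ≤ ε < 1`, every `A_n`-coordinate-symmetric SDP extended formulation
approximating the perfect matching problem within a factor of `1 − ε/(n−1)` has size at least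
`2^{αn}`" [BraunEtAl2016].  The tree PROVES this (`BraunEtAl2016_symmetricSDP_matching_holds`,
`MatchingSubgroupEquivariantPsdBound.lean`) in the `∃ α, ∃ n₀` form, the constant being inherited from
Grigoriev's degree bound `Grigoriev2001_mod2Degree_holds` (Tseitin route on explicit expanders:
`c = 9/(160·631¹⁶·(1 + 2 dX))`, threshold `56·631¹⁶·(1 + 2 dX)`).

This sink module makes the constant EXPLICIT, feeding the explicit MOD 2 degree bound
`Grigoriev2001_mod2Degree_oneThird` (`Mod2SosDegreeExplicit.lean`: a half-degree-`d` refutation of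
`MOD2_m`, `m ≥ 2`, forces `m/3 ≤ 2d`, from the story pseudo-expectation — Potechin 2019 Thm 1.2 in the
range the tree proves) through the printed proof of Thm. 4.10 with the bookkeeping made parametric:

* `thetaRank_linear_shift_of` — Theorem B of `MatchingSubgroupEquivariantPsdBound.lean` for ANY
  explicit MOD 2 bound `(c, m₀)`: degree-`k` sums of squares for all `ε`-shifted odd-cut slacks force
  `(c/16)·n ≤ k` once `n ≥ max (2m₀+4) (⌈8/c⌉+4)`;
* `two_pow_le_of_sos_of` — the counting endgame for ANY explicit Theorem-B bound `(c, n₁)`: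
  `d ≥ 2^{αn}` with `α = min (1/16) (c/6)`, `n ≥ max n₁ (max 20 ⌈2/c⌉)`;
* `symmetricSDP_matching_of_affBound` — the SDP bridge of `BraunEtAl2016_symmetricSDP_matching_holds`
  for ANY explicit affine bound `(α, n₀)`;

and the instances (`c = 1/3`, `m₀ = 2` ⇒ Theorem B with `1/48`, `n ≥ 28` ⇒ `α = 1/288`, `n ≥ 96`):

* `matchingSubgroupEquivariantPsdBound_explicit` — for every `0 ≤ ε < 1`, every even `n ≥ 96`, every
  subgroup `G ≤ 𝔖ₙ` with `[𝔖ₙ : G] < 2^{n/288}` and every `d`: a `G`-equivariant psd factorization of the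
  `ε`-shifted odd-cut slack matrix of `P_PM(K_n)` of size `d` has `d ≥ 2^{n/288}`
  (`subgroupEquivariantPsdBoundAff_explicit`: affine form);
* `matchingEquivariantPsdBound_explicit` — the `𝔖ₙ`-equivariant case `ε = 0` (`n ≥ 96`: `d ≥ 2^{n/288}`);
* `BraunEtAl2016_symmetricSDP_matching_explicit` — **every `A_n`-coordinate-symmetric
  `(max f + ε/2)`-approximate SDP formulation of `PM_n` (Def. 2.2), `n ≥ 576` even, `0 ≤ ε < 1`, has size
  `d ≥ 2^{n/288}`** (the body of the named fact with `α = 1/288`, `n₀ = 576`).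

No definitions, no named facts; the proofs are those of `MatchingSubgroupEquivariantPsdBound.lean`
with the constants threaded as parameters (the `∃`-statements there are unchanged and not restated).
The constants are NOT optimised (`2^{n/288}`; the printed proof gives no numerical value).

## References

* G. Braun et al., Math. Program. 165 (2017), Thm. 4.10 (p. 9, proof pp. 9–10), Lemma 2.3 (p. 5),
  §4.5 (p. 10). [BraunEtAl2016]
* A. Potechin, ITCS 2019, LIPIcs 124:61, Thm 1.2 (p. 4). [Potechin2019]
* D. Grigoriev, Theoret. Comput. Sci. 259 (2001), Cor. 2 (p. 622). [Grigoriev2001TCS]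
-/

noncomputable section

open Finset Matrix

namespace Literature.Combinatorics.Optimization

open Literature.Barriers.PneNP Literature.Computability.Complexity

/-! ### Theorem B with the MOD 2 bound as a parameter -/

/-- **Theorem B, parametric in the MOD 2 degree bound.** If every static SOS refutation of `MOD2_m`,
`m ≥ m₀`, of half-degree `d` has `c·m ≤ 2d` (`c > 0`), then for even `n ≥ max (2m₀+4) (⌈8/c⌉+4)`,
every `ε < 1` and every `k`: if every `ε`-shifted odd-cut slack of `K_n` is a sum of squares of
functions of degree `≤ k`, then `(c/16)·n ≤ k`.  (Proof of `thetaRank_linear_shift` verbatim: odd `U`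
with `|U| ∈ {n/2−1, n/2}`, `polLELift`, Thm. 4.9 `Mod2.matchingEffectiveDerivationV`,
`oddCutRestrictionShift`, the bound at `m = |U|`, `d = 2k+1`.)
[cite: BraunEtAl2016, Thm. 4.9 (p. 9) and Thm. 4.10 (proof, pp. 9–10)] [cite: Grigoriev2001TCS, Cor. 2] -/
theorem thetaRank_linear_shift_of {c : ℝ} (hc : 0 < c) {m₀ : ℕ}
    (hG : ∀ m : ℕ, m₀ ≤ m → ∀ d : ℕ, HasSOSRefutation (Mod2.system m) d → c * m ≤ 2 * d) :
    ∀ n : ℕ, max (2 * m₀ + 4) (⌈8 / c⌉₊ + 4) ≤ n → Even n → ∀ ε : ℝ, ε < 1 → ∀ k : ℕ,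
      (∀ U : Finset (Fin n), Odd U.card → ∃ (s : ℕ) (g : Fin s → (PMSol n → ℝ)),
        (∀ j, g j ∈ polLE n k) ∧ ∀ M : PMSol n, pmSlack U M.1 + ε = ∑ j, (g j M) ^ 2) →
      c / 16 * n ≤ k := by
  classical
  -- for even `n ≥ 2` there is an odd `m` with `n - 2 ≤ 2m ≤ n`
  have exists_odd_half : ∀ {n : ℕ}, Even n → 2 ≤ n → ∃ m : ℕ, Odd m ∧ 2 * m ≤ n ∧ n ≤ 2 * m + 2 := by
    intro n hn h2
    obtain ⟨a, rfl⟩ := hn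
    rcases Nat.even_or_odd a with ha | ha
    · obtain ⟨b, rfl⟩ := ha
      exact ⟨b + b - 1, ⟨b - 1, by omega⟩, by omega, by omega⟩
    · exact ⟨a, ha, by omega, by omega⟩
  intro n hn heven ε hε k hsos
  have hn₀ : 2 * m₀ + 4 ≤ n := le_trans (le_max_left _ _) hn
  have hn8 : ⌈8 / c⌉₊ + 4 ≤ n := le_trans (le_max_right _ _) hn
  have hcn : 8 + 4 * c ≤ c * n := by
    have h8c : (8 / c : ℝ) ≤ (n : ℝ) - 4 := by
      have h1 : (8 / c : ℝ) ≤ ⌈8 / c⌉₊ := Nat.le_ceil _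
      have h2 : ((⌈8 / c⌉₊ : ℕ) : ℝ) + 4 ≤ n := by exact_mod_cast hn8
      linarith
    have : c * (8 / c) = 8 := by field_simp
    nlinarith [mul_le_mul_of_nonneg_left h8c hc.le]
  -- an odd vertex set `U` with `|U| ∈ {n/2 - 1, n/2}`
  obtain ⟨m, hmodd, hmle, hmge⟩ := exists_odd_half heven (by omega)
  obtain ⟨U, -, hUcard⟩ := Finset.exists_subset_card_eq
    (show m ≤ (Finset.univ : Finset (Fin n)).card by simp; omega)
  have hUodd : Odd U.card := hUcard ▸ hmodd
  obtain ⟨s, g, hg, hsum⟩ := hsos U hUodd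
  -- lift the squares to polynomials of degree ≤ k
  choose Gp hGdeg hGeval using fun j => polLELift n k (g j) (hg j)
  set F : MvPolynomial (KnEdge n) ℝ := (cutPoly U + MvPolynomial.C ε) - ∑ j, Gp j * Gp j with hF
  have hFvan : ∀ M : Finset (Sym2 (Fin n)), IsPMOn Finset.univ M →
      MvPolynomial.eval (edgeIndicator M) F = 0 := by
    intro M hM
    have hs := hsum ⟨M, hM⟩
    simp only [hF, map_sub, map_add, map_sum, map_mul, MvPolynomial.eval_C,
      eval_cutPoly_edgeIndicator U hM]
    rw [sub_eq_zero, hs]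
    refine Finset.sum_congr rfl fun j _ => ?_
    rw [hGeval j ⟨M, hM⟩, pow_two]
  have hFdeg : F.totalDegree ≤ 2 * k + 1 := by
    rw [hF]
    refine le_trans (MvPolynomial.totalDegree_sub _ _) (max_le ?_ ?_)
    · refine le_trans (MvPolynomial.totalDegree_add _ _) (max_le ?_ ?_)
      · exact le_trans (totalDegree_cutPoly_le U) (by omega)
      · rw [MvPolynomial.totalDegree_C]; omega
    · refine le_trans (MvPolynomial.totalDegree_finsetSum _ _) (Finset.sup_le fun j _ => ?_)
      refine le_trans (MvPolynomial.totalDegree_mul _ _) ?_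
      have := hGdeg j
      omega
  -- effective derivation of the defect (BBCHPRRWZ Thm 4.9)
  obtain ⟨g', hg'deg, hg'sum⟩ := Mod2.matchingEffectiveDerivationV n heven F hFvan
  have hcert : HasSOSCertificate (Mod2.system n) (cutPoly U + MvPolynomial.C ε) (2 * k + 1) := by
    refine ⟨s, Gp, g', fun j => le_trans (hGdeg j) (by omega),
      fun e => le_trans (hg'deg e) (by omega), ?_⟩
    rw [hg'sum, hF]
    abel
  -- restriction to `K_{|U|}` (BBCHPRRWZ §4.5, shifted) and the MOD 2 bound
  have href : HasSOSRefutation (Mod2.system U.card) (2 * k + 1) :=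
    oddCutRestrictionShift n heven U hUodd (by rw [hUcard]; exact hmle) ε hε (2 * k + 1) hcert
  have hGr := hG U.card (by rw [hUcard]; omega) (2 * k + 1) href
  rw [hUcard] at hGr
  push_cast at hGr
  have hmr : (n : ℝ) ≤ 2 * m + 2 := by exact_mod_cast hmge
  nlinarith [hmr, hGr, hcn, hc]

/-- **Theorem B with explicit constants**: for even `n ≥ 28`, `ε < 1` and every `k`, degree-`k` sums
of squares for all `ε`-shifted odd-cut slacks force `n/48 ≤ k` (`c = 1/3`, `m₀ = 2` from
`Grigoriev2001_mod2Degree_oneThird`). [cite: BraunEtAl2016, Thm. 4.10 (proof, pp. 9–10)] [cite: Potechin2019, Thm 1.2 (p. 4)] -/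
theorem thetaRank_linear_shift_explicit :
    ∀ n : ℕ, 28 ≤ n → Even n → ∀ ε : ℝ, ε < 1 → ∀ k : ℕ,
      (∀ U : Finset (Fin n), Odd U.card → ∃ (s : ℕ) (g : Fin s → (PMSol n → ℝ)),
        (∀ j, g j ∈ polLE n k) ∧ ∀ M : PMSol n, pmSlack U M.1 + ε = ∑ j, (g j M) ^ 2) →
      (1 / 48 : ℝ) * n ≤ k := by
  intro n hn heven ε hε k hsos
  have h := thetaRank_linear_shift_of (c := 1 / 3) (by norm_num) (m₀ := 2)
    Grigoriev2001_mod2Degree_oneThird n ?_ heven ε hε k hsos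
  · linarith
  · refine max_le (by omega) ?_
    have : ⌈(8 : ℝ) / (1 / 3)⌉₊ ≤ 24 := Nat.ceil_le.2 (by norm_num)
    omega

/-! ### The counting endgame with Theorem B as a parameter -/

/-- **The counting endgame, parametric in Theorem B.** If degree-`k` sums of squares for all
`ε`-shifted odd-cut slacks force `c·n ≤ k` (even `n ≥ n₁`, `ε < 1`), then with `α = min (1/16) (c/6)`
and `n ≥ max n₁ (max 20 ⌈2/c⌉)`: whenever `[𝔖ₙ:G] < 2^{αn}` and, for every `k` with `4k+2 ≤ n` and
`[𝔖ₙ:G]·d² < 2^k`, the shifted slacks are sums of squares of degree `≤ k`, then `2^{αn} ≤ d`.  (Proof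
of `two_pow_le_of_sos` verbatim.) [cite: BraunEtAl2016, Thm. 4.10 (proof, pp. 9–10)] -/
theorem two_pow_le_of_sos_of {c : ℝ} (hc : 0 < c) {n₁ : ℕ}
    (hB : ∀ n : ℕ, n₁ ≤ n → Even n → ∀ ε : ℝ, ε < 1 → ∀ k : ℕ,
      (∀ U : Finset (Fin n), Odd U.card → ∃ (s : ℕ) (g : Fin s → (PMSol n → ℝ)),
        (∀ j, g j ∈ polLE n k) ∧ ∀ M : PMSol n, pmSlack U M.1 + ε = ∑ j, (g j M) ^ 2) →
      c * n ≤ k) :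
    ∀ ε : ℝ, 0 ≤ ε → ε < 1 → ∀ n : ℕ, max n₁ (max 20 ⌈2 / c⌉₊) ≤ n → Even n →
      ∀ G : Subgroup (Equiv.Perm (Fin n)), (G.index : ℝ) < (2 : ℝ) ^ (min (1 / 16) (c / 6) * n) →
        ∀ d : ℕ,
          (∀ k : ℕ, 4 * k + 2 ≤ n → G.index * d ^ 2 < 2 ^ k →
            ∀ U : Finset (Fin n), Odd U.card → ∃ (s : ℕ) (g : Fin s → (PMSol n → ℝ)),
              (∀ j, g j ∈ polLE n k) ∧ ∀ M : PMSol n, pmSlack U M.1 + ε = ∑ j, (g j M) ^ 2) →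
          (2 : ℝ) ^ (min (1 / 16) (c / 6) * n) ≤ d := by
  classical
  intro ε hε0 hε1 n hn heven G hGidx d hT
  have hn₁ : n₁ ≤ n := le_trans (le_max_left _ _) hn
  have h20 : 20 ≤ n := le_trans (le_trans (le_max_left _ _) (le_max_right _ _)) hn
  have hNc : ⌈2 / c⌉₊ ≤ n := le_trans (le_trans (le_max_right _ _) (le_max_right _ _)) hn
  have hcn : 2 ≤ c * n := by
    have h2c : (2 / c : ℝ) ≤ n := le_trans (Nat.le_ceil _) (by exact_mod_cast hNc)
    have : c * (2 / c) = 2 := by field_simp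
    nlinarith [mul_le_mul_of_nonneg_left h2c hc.le]
  set α : ℝ := min (1 / 16) (c / 6) with hα
  have hα16 : α ≤ 1 / 16 := min_le_left _ _
  have hαc : α ≤ c / 6 := min_le_right _ _
  have hαpos : 0 < α := lt_min (by norm_num) (by positivity)
  have hn0 : (0 : ℝ) ≤ n := Nat.cast_nonneg n
  have h20' : (20 : ℝ) ≤ n := by exact_mod_cast h20
  -- the index is a positive natural number
  set I : ℕ := G.index with hI
  have hIpos : 0 < I := Nat.pos_of_ne_zero G.index_ne_zero_of_finite
  have hIpos' : (0 : ℝ) < I := by exact_mod_cast hIpos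
  set L : ℕ := Nat.log 2 (I * d ^ 2) with hL
  have hdlt : I * d ^ 2 < 2 ^ (L + 1) := Nat.lt_pow_succ_log_self (by norm_num) _
  have key : 3 * (α * n) ≤ (L : ℝ) ∧ 1 ≤ d := by
    by_cases hk : 4 * (L + 1) + 2 ≤ n
    · have hsos := hT (L + 1) hk hdlt
      have hB' : c * n ≤ ((L + 1 : ℕ) : ℝ) := hB n hn₁ heven ε hε1 (L + 1) hsos
      push_cast at hB'
      refine ⟨?_, ?_⟩
      · nlinarith [mul_le_mul_of_nonneg_right hαc hn0]
      · by_contra hd0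
        push Not at hd0
        have hd : d = 0 := by omega
        have hL0 : L = 0 := by rw [hL, hd]; simp
        rw [hL0] at hB'
        push_cast at hB'
        linarith
    · push Not at hk
      have hkr : (n : ℝ) ≤ 4 * L + 5 := by exact_mod_cast (by omega : n ≤ 4 * L + 5)
      refine ⟨?_, ?_⟩
      · nlinarith [mul_le_mul_of_nonneg_right hα16 hn0]
      · by_contra hd0
        push Not at hd0
        have hd : d = 0 := by omega
        have hL0 : L = 0 := by rw [hL, hd]; simp
        omega
  obtain ⟨hαL, hd1⟩ := key
  have hpow : (2 : ℝ) ^ (L : ℝ) ≤ (I : ℝ) * (d : ℝ) ^ 2 := by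
    rw [Real.rpow_natCast]
    have := Nat.pow_log_le_self 2 (by positivity : I * d ^ 2 ≠ 0)
    exact_mod_cast this
  have h3αn : (2 : ℝ) ^ (3 * (α * n)) ≤ (2 : ℝ) ^ (L : ℝ) :=
    Real.rpow_le_rpow_of_exponent_le (by norm_num) hαL
  have hx : 0 < (2 : ℝ) ^ (α * n) := by positivity
  have hsqI : ((2 : ℝ) ^ (α * n)) ^ 2 * I ≤ (I : ℝ) * (d : ℝ) ^ 2 := by
    have h1 : ((2 : ℝ) ^ (α * n)) ^ 2 * I ≤ ((2 : ℝ) ^ (α * n)) ^ 2 * (2 : ℝ) ^ (α * n) :=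
      mul_le_mul_of_nonneg_left hGidx.le (by positivity)
    have h2 : ((2 : ℝ) ^ (α * n)) ^ 2 * (2 : ℝ) ^ (α * n) = (2 : ℝ) ^ (3 * (α * n)) := by
      rw [pow_two, ← Real.rpow_add (by norm_num), ← Real.rpow_add (by norm_num)]
      ring_nf
    rw [h2] at h1
    exact h1.trans (h3αn.trans hpow)
  have hsq : ((2 : ℝ) ^ (α * n)) ^ 2 ≤ (d : ℝ) ^ 2 := by
    have := hsqI
    rw [mul_comm (I : ℝ) _] at this
    exact le_of_mul_le_mul_right this hIpos'
  have hdnn : (0 : ℝ) ≤ d := Nat.cast_nonneg d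
  exact (pow_le_pow_iff_left₀ hx.le hdnn two_ne_zero).1 hsq

/-! ### Explicit R2-full -/

/-- **R2-full with explicit constants: subgroup-equivariant psd factorizations of the matching
polytope have size `≥ 2^{n/288}`.** For every `0 ≤ ε < 1`, every even `n ≥ 96`, every subgroup
`G ≤ 𝔖ₙ` with `[𝔖ₙ : G] < 2^{n/288}` and every `d`: a `G`-equivariant psd factorization of the
`ε`-shifted odd-cut slack matrix of `P_PM(K_n)` has `d ≥ 2^{n/288}` (explicit form of
`matchingSubgroupEquivariantPsdBound`). [cite: BraunEtAl2016, Thm. 4.10 (p. 9)] [cite: Potechin2019, Thm 1.2 (p. 4)] -/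
theorem matchingSubgroupEquivariantPsdBound_explicit :
    ∀ ε : ℝ, 0 ≤ ε → ε < 1 → ∀ n : ℕ, 96 ≤ n → Even n →
      ∀ G : Subgroup (Equiv.Perm (Fin n)), (G.index : ℝ) < (2 : ℝ) ^ ((n : ℝ) / 288) →
        ∀ d : ℕ, HasSubgroupEquivariantPsdFactorization n d G ε → (2 : ℝ) ^ ((n : ℝ) / 288) ≤ d := by
  intro ε hε0 hε1 n hn heven G hG d hfac
  have h := two_pow_le_of_sos_of (c := 1 / 48) (by norm_num) (n₁ := 28) thetaRank_linear_shift_explicit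
    ε hε0 hε1 n ?_ heven G ?_ d
    (fun k hk hd => sos_of_subgroupEquivariantPsdFactorization n k d G ε heven hk hd hfac)
  · have hmin : min (1 / 16 : ℝ) (1 / 48 / 6) * n = (n : ℝ) / 288 := by norm_num; ring
    rwa [hmin] at h
  · refine max_le (by omega) (max_le (by omega) ?_)
    have : ⌈(2 : ℝ) / (1 / 48)⌉₊ ≤ 96 := Nat.ceil_le.2 (by norm_num)
    omega
  · have hmin : min (1 / 16 : ℝ) (1 / 48 / 6) * n = (n : ℝ) / 288 := by norm_num; ring
    rwa [hmin]

/-- **R2-full, affine form, explicit constants** (`pmSlack U M + ε = tr(A(M) B(U)) + μ(U)`, `μ ≥ 0`).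
[cite: BraunEtAl2016, Lemma 2.3 (p. 5) and Thm. 4.10 (p. 9)] -/
theorem subgroupEquivariantPsdBoundAff_explicit :
    ∀ ε : ℝ, 0 ≤ ε → ε < 1 → ∀ n : ℕ, 96 ≤ n → Even n →
      ∀ G : Subgroup (Equiv.Perm (Fin n)), (G.index : ℝ) < (2 : ℝ) ^ ((n : ℝ) / 288) →
        ∀ (d : ℕ) (ρ : G →* GL (Fin d) ℝ) (A : Finset (Sym2 (Fin n)) → Matrix (Fin d) (Fin d) ℝ)
          (B : Finset (Fin n) → Matrix (Fin d) (Fin d) ℝ) (μ : Finset (Fin n) → ℝ),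
          IsSubgroupEquivariantPsdFactorizationAff n d G ε ρ A B μ → (2 : ℝ) ^ ((n : ℝ) / 288) ≤ d := by
  intro ε hε0 hε1 n hn heven G hG d ρ A B μ hfac
  have h := two_pow_le_of_sos_of (c := 1 / 48) (by norm_num) (n₁ := 28) thetaRank_linear_shift_explicit
    ε hε0 hε1 n ?_ heven G ?_ d
    (fun k hk hd => sos_of_subgroupEquivariantPsdFactorizationAff n k d G ε ρ A B μ heven hk hd hfac)
  · have hmin : min (1 / 16 : ℝ) (1 / 48 / 6) * n = (n : ℝ) / 288 := by norm_num; ring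
    rwa [hmin] at h
  · refine max_le (by omega) (max_le (by omega) ?_)
    have : ⌈(2 : ℝ) / (1 / 48)⌉₊ ≤ 96 := Nat.ceil_le.2 (by norm_num)
    omega
  · have hmin : min (1 / 16 : ℝ) (1 / 48 / 6) * n = (n : ℝ) / 288 := by norm_num; ring
    rwa [hmin]

/-! ### The SDP bridge with the affine bound as a parameter, and Thm. 4.10 with explicit constants -/

/-- **The SDP bridge, parametric.** If every affine `G`-equivariant psd factorization of the
`ε`-shifted odd-cut slack of `K_n` (`n ≥ n₀` even, `[𝔖ₙ:G] < 2^{αn}`) has size `≥ 2^{αn}`, then every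
`A_n`-coordinate-symmetric `(max f + ε/2)`-approximate SDP formulation of `PM_n` of size `d`,
`n ≥ max n₀ (max 2 ⌈2/α⌉)`, has `2^{αn} ≤ d` (proof of `BraunEtAl2016_symmetricSDP_matching_holds`
verbatim: Lemma 2.3 + the slack identity of §4.5 + `[𝔖ₙ : A_n] = 2 < 2^{αn}`).
[cite: BraunEtAl2016, Thm. 4.10 (p. 9, proof pp. 9–10) and Lemma 2.3 (p. 5)] -/
theorem symmetricSDP_matching_of_affBound {α : ℝ} (hα : 0 < α) {n₀ : ℕ}
    (h : ∀ ε : ℝ, 0 ≤ ε → ε < 1 → ∀ n : ℕ, n₀ ≤ n → Even n →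
      ∀ G : Subgroup (Equiv.Perm (Fin n)), (G.index : ℝ) < (2 : ℝ) ^ (α * n) →
        ∀ (d : ℕ) (ρ : G →* GL (Fin d) ℝ) (A : Finset (Sym2 (Fin n)) → Matrix (Fin d) (Fin d) ℝ)
          (B : Finset (Fin n) → Matrix (Fin d) (Fin d) ℝ) (μ : Finset (Fin n) → ℝ),
          IsSubgroupEquivariantPsdFactorizationAff n d G ε ρ A B μ → (2 : ℝ) ^ (α * n) ≤ d) :
    ∀ n : ℕ, max n₀ (max 2 ⌈2 / α⌉₊) ≤ n → Even n → ∀ ε : ℝ, 0 ≤ ε → ε < 1 →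
      ∀ (d : ℕ) (E : SDPFormulation (pmProblem n ε) d)
        (ρ : alternatingGroup (Fin n) →* Equiv.Perm (Fin d)),
        E.IsCoordSymmetric ρ → (2 : ℝ) ^ (α * n) ≤ d := by
  classical
  intro n hn heven ε hε0 hε1 d E ρ hE
  have hn₀ : n₀ ≤ n := le_trans (le_max_left _ _) hn
  have h2 : 2 ≤ n := le_trans (le_trans (le_max_left _ _) (le_max_right _ _)) hn
  have hNα : ⌈2 / α⌉₊ ≤ n := le_trans (le_trans (le_max_right _ _) (le_max_right _ _)) hn
  haveI : Nontrivial (Fin n) := Fin.nontrivial_iff_two_le.mpr h2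
  have hidx : ((alternatingGroup (Fin n)).index : ℝ) < (2 : ℝ) ^ (α * n) := by
    rw [alternatingGroup.index_eq_two]
    have hαn : (1 : ℝ) < α * n := by
      have h2c : (2 / α : ℝ) ≤ n := le_trans (Nat.le_ceil _) (by exact_mod_cast hNα)
      have : α * (2 / α) = 2 := by field_simp
      nlinarith [mul_le_mul_of_nonneg_left h2c hα.le]
    calc ((2 : ℕ) : ℝ) = (2 : ℝ) ^ (1 : ℝ) := by norm_num
      _ < (2 : ℝ) ^ (α * n) := Real.rpow_lt_rpow_of_exponent_lt (by norm_num) hαn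
  -- the factorization theorem, objective by objective
  let F : Finset (Fin n) → EdgeSet n := fun U =>
    ⟨U.sym2.filter fun e => ¬e.IsDiag, fun e he => (mem_filter.1 he).2⟩
  choose Uf hUf μf hμf hslack using fun U : Finset (Fin n) =>
    E.exists_posSemidef_slack (pmProblem_sound ε (F U))
  refine h ε hε0 hε1 n hn₀ heven _ hidx d
    ((Matrix.permMatrixHom (n := Fin d) (R := ℝ)).toHomUnits.comp ρ)
    (fun M => if hM : IsPMOn univ M then E.X ⟨M, hM⟩ else 0) (fun U => (2 : ℝ) • Uf U)
    (fun U => 2 * μf U) ⟨?_, ?_, ?_, ?_, ?_⟩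
  · intro M hM
    dsimp only
    rw [dif_pos hM]
    exact E.posSemidef_X _
  · intro U _
    exact (hUf U).smul zero_le_two
  · intro U _
    have := hμf U
    positivity
  · intro U M hU hM
    dsimp only
    rw [dif_pos hM]
    have hid := two_mul_pmSlack_inner_eq ε ⟨U, hU⟩ ⟨M, hM⟩ (F U) rfl
    rw [hslack U ⟨M, hM⟩] at hid
    have hps : pmOddCutSlack n ⟨U, hU⟩ ⟨M, hM⟩ = pmSlack U M := by
      rw [pmOddCutSlack_apply, cc_eq_card_filter]
      rfl
    rw [← hps, ← hid, Matrix.mul_smul, trace_smul, smul_eq_mul, Matrix.trace_mul_comm]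
    ring
  · intro σ M hM
    have hσM : IsPMOn univ (permEdges (σ : Equiv.Perm (Fin n)) M) := isPMOn_univ_image_map _ hM
    dsimp only
    rw [dif_pos hσM, dif_pos hM]
    have h1 : E.X ⟨permEdges (σ : Equiv.Perm (Fin n)) M, hσM⟩ = permAct (ρ σ) (E.X ⟨M, hM⟩) :=
      hE.X_smul σ ⟨M, hM⟩
    rw [h1, MonoidHom.comp_apply, MonoidHom.coe_toHomUnits, Matrix.permMatrixHom_apply]
    exact permAct_eq_permMatrix_mul_mul_transpose (ρ σ) _

/-- **Braun et al. 2016, Theorem 4.10 with explicit constants: every `A_n`-coordinate-symmetric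
`(max f + ε/2)`-approximate SDP formulation of the perfect matching problem `PM_n` (Def. 2.2),
`n ≥ 576` even, `0 ≤ ε < 1`, has size `d ≥ 2^{n/288}`** — the body of the named fact
`BraunEtAl2016_symmetricSDP_matching` with `α = 1/288`, `n₀ = 576` (the tree's discharge
`BraunEtAl2016_symmetricSDP_matching_holds` gives an unspecified `α`).
[cite: BraunEtAl2016, Thm. 4.10 (p. 9)] [cite: Potechin2019, Thm 1.2 (p. 4)] -/
theorem BraunEtAl2016_symmetricSDP_matching_explicit :
    ∀ n : ℕ, 576 ≤ n → Even n → ∀ ε : ℝ, 0 ≤ ε → ε < 1 →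
      ∀ (d : ℕ) (E : SDPFormulation (pmProblem n ε) d)
        (ρ : alternatingGroup (Fin n) →* Equiv.Perm (Fin d)),
        E.IsCoordSymmetric ρ → (2 : ℝ) ^ ((n : ℝ) / 288) ≤ d := by
  intro n hn heven ε hε0 hε1 d E ρ hE
  have haff : ∀ ε : ℝ, 0 ≤ ε → ε < 1 → ∀ n : ℕ, 96 ≤ n → Even n →
      ∀ G : Subgroup (Equiv.Perm (Fin n)), (G.index : ℝ) < (2 : ℝ) ^ ((1 / 288 : ℝ) * n) →
        ∀ (d : ℕ) (ρ : G →* GL (Fin d) ℝ) (A : Finset (Sym2 (Fin n)) → Matrix (Fin d) (Fin d) ℝ)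
          (B : Finset (Fin n) → Matrix (Fin d) (Fin d) ℝ) (μ : Finset (Fin n) → ℝ),
          IsSubgroupEquivariantPsdFactorizationAff n d G ε ρ A B μ → (2 : ℝ) ^ ((1 / 288 : ℝ) * n) ≤ d := by
    intro ε hε0 hε1 n hn heven G hG d ρ A B μ hfac
    have hmul : (1 / 288 : ℝ) * n = (n : ℝ) / 288 := by ring
    rw [hmul] at hG ⊢
    exact subgroupEquivariantPsdBoundAff_explicit ε hε0 hε1 n hn heven G hG d ρ A B μ hfac
  have h := symmetricSDP_matching_of_affBound (α := 1 / 288) (by norm_num) (n₀ := 96) haff n ?_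
    heven ε hε0 hε1 d E ρ hE
  · have hmul : (1 / 288 : ℝ) * n = (n : ℝ) / 288 := by ring
    rwa [hmul] at h
  · refine max_le (by omega) (max_le (by omega) ?_)
    have : ⌈(2 : ℝ) / (1 / 288)⌉₊ ≤ 576 := Nat.ceil_le.2 (by norm_num)
    omega

/-- **The `𝔖ₙ`-equivariant case (Fawzi–Saunderson–Parrilo vocabulary, `ε = 0`) with explicit
constants**: for even `n ≥ 96`, every `𝔖ₙ`-equivariant psd factorization of the odd-cut slack matrix
of `P_PM(K_n)` (arbitrary real representation on the matching side) has size `d ≥ 2^{n/288}` — the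
explicit form of `matchingEquivariantPsdBound` (`MatchingEquivariantPsdLowerBound.lean`), via
`[𝔖ₙ : 𝔖ₙ] = 1 < 2^{n/288}`. [cite: FawziSaundersonParrilo2013, Thm. 1 (p. 3) and §6 (p. 20)] [cite: BraunEtAl2016, Thm. 4.10 (p. 10)] -/
theorem matchingEquivariantPsdBound_explicit :
    ∀ n : ℕ, 96 ≤ n → Even n → ∀ d : ℕ,
      HasEquivariantPsdFactorization n d → (2 : ℝ) ^ ((n : ℝ) / 288) ≤ d := by
  intro n hn heven d hfac
  refine matchingSubgroupEquivariantPsdBound_explicit 0 le_rfl zero_lt_one n hn heven ⊤ ?_ d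
    hfac.hasSubgroupEquivariantPsdFactorization_top
  rw [Subgroup.index_top, Nat.cast_one]
  exact Real.one_lt_rpow (by norm_num) (by positivity)

end Literature.Combinatorics.Optimization

end
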